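import Summits.HodgeConjecture.HodgeConjecture.Theorems.PadicSemiregularLiftFormalLiftingFromClassLiftingGlue

/-!
# Sketch — crux-ideate round 2, ideator 4 (planner-cruxidea-stmt-HodgeConjecture-13825-4-0)

Typed first lemmas of the two round-2 crux idea cards for `FormalLiftingFromClassLifting`
(stmt-HodgeConjecture-13825):

* card `hu-infinitesimal-obstruction`: `LevelwiseClassLift` (level-wise (1_K), NO compatibility) and
  `KernelTower` ((2_K), verbatim the `twoK` hypothesis of the landed glue), with the sorry-free
  composition `crux_of_levelwise_of_kernelTower` over the LANDED theorems
  `Glue.stepClassLifting_of_levelwiseLifts_of_kernelTower` and `Glue.liftsFormally_of_stepClassLifting`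
  — so the line's only Lean-facing stubs are these two K₀-shadows, each of which the card derives
  from X. Hu, arXiv:2507.12458, Prop. 11.1(i) / Cor. 10.5(i) (named-fact targets over a COHERENT
  carrier) plus a coherent lattice lemma.
* card `stable-range-devissage`: `StableRangeGeneration` (Serre-splitting shadow: K₀ of a thickening
  is generated by bundles of rank ≤ d) and `SurfaceTowerFromPic` (the d ≤ 2 corner: level-wise (1_K)
  and (2_K) from H²(𝒳,𝒪)[p] = 0 ALONE, p odd, no bound on p, no Ω¹ hypothesis).
-/

set_option linter.dupNamespace false

namespace Summit.HodgeConjecture.HodgeConjecture.Cruxes.FormalLiftingFromClassLifting.IdeatorFour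

open CategoryTheory AlgebraicGeometry Limits
open Literature.AlgebraicGeometry Literature.AlgebraicGeometry.Motives
open Literature.AlgebraicGeometry.Motives.WittScheme
open Summit.HodgeConjecture.HodgeConjecture.Theses.PadicSemiregularLift
open Summit.HodgeConjecture.HodgeConjecture.Theorems.FormalLiftingFromClassLifting

noncomputable section

/-- The crux's hypothesis block on `𝒳`, verbatim (smooth proper model of relative dimension `d`,
projective over `W`, `d + 6 < p`, `H^b(𝒳,𝒪)` and `H^b(𝒳,Ω¹)` without `p`-torsion, `d ≤ 3 ∨ Ω¹ free`). -/
def CruxHypotheses (p : ℕ) [Fact p.Prime] (k : Type) [Field k] [CharP k p] (d : ℕ)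
    (𝒳 : SchemeOver (WittVector p k)) : Prop :=
  IsSmoothProperModel d 𝒳 ∧ Crystalline.IsProjectiveOverRing 𝒳 ∧ d + 6 < p ∧
    (∀ (b : ℕ) (x : structureSheafCohomology 𝒳.left b), (p : ℤ) • x = 0 → x = 0) ∧
    (∀ (b : ℕ) (x : hodgeCohomologyOne 𝒳 b), (p : ℤ) • x = 0 → x = 0) ∧
    (d ≤ 3 ∨ Nonempty (cotangentSheaf 𝒳 ≅ SheafOfModules.free (R := 𝒳.left.ringCatSheaf) (Fin d)))

/-- The crux's rational pro-lift hypothesis (Bloch–Esnault–Kerz Thm 1.3 (b)), verbatim. -/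
def RationalProLift {p : ℕ} [Fact p.Prime] {k : Type} [Field k] [CharP k p] [PerfectRing k p]
    (𝒳 : SchemeOver (WittVector p k)) (E₁ : (specialFibre 𝒳).left.Modules)
    (hE₁ : IsFiniteLocallyFree E₁) : Prop :=
  ∃ ξ : KTheory.ContinuousKZeroRat (Ideal.span {(p : WittVector p k)}) 𝒳,
    KTheory.KZeroRat.map (Crystalline.specialFibreToTower 𝒳)
      (KTheory.ContinuousKZeroRat.specialFibre (Ideal.span {(p : WittVector p k)}) 𝒳 ξ) =
      KTheory.KZeroRat.of E₁ hE₁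

/-- **Card `hu-infinitesimal-obstruction`, first lemma (LEVEL-WISE (1_K), no compatibility).**
Under the crux hypotheses, a finite locally free `E₁` on `X_k` with a rational pro-lift has its
INTEGRAL class in the image of `K₀(X_{n+1}) → K₀(X_k)` for EVERY `n`. Paper proof of the card:
Hu arXiv:2507.12458 Prop. 11.1(i) at `(m,n) = (1, n+1)` gives `[E₁]` lifts to `X_{n+1}` iff
`ob_{1,n+1}[E₁] = 0` in `⊕_{r=1}^{d-1} ℍ^{2r}(X_1, p(r)Ω•_{X_{n+1}})`; the family `(ob_{1,n}[E₁])_n` is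
compatible (Prop. 9.6), killed by the denominator `L` of the rational pro-lift (`L[E₁] = η_1` lifts
to every level), and lives in `lim_n ℍ^{2r}(X_1,p(r)Ω•_{X_n})`, torsion-free under torsion-free Hodge
cohomology (coherent lattice lemma + Hu Lemma 11.3) — hence zero. -/
def LevelwiseClassLift : Prop :=
  ∀ (p : ℕ) [Fact p.Prime] (k : Type) [Field k] [CharP k p] [PerfectRing k p] (d : ℕ)
    (𝒳 : SchemeOver (WittVector p k)), CruxHypotheses p k d 𝒳 →
    ∀ (E₁ : (specialFibre 𝒳).left.Modules) (hE₁ : IsFiniteLocallyFree E₁),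
      RationalProLift 𝒳 E₁ hE₁ →
      ∀ n : ℕ, ∃ z : KTheory.KZero (thickening 𝒳 (n + 1)).left,
        KTheory.KZero.map (specialFibreToThickening 𝒳 n) z = KTheory.KZero.of E₁ hE₁

/-- **(2_K) KERNEL TOWER**, verbatim the `twoK` hypothesis of the landed glue / the disprover's
`KernelTowerSurjective`: every class on `X_{n+1}` dying on `X_k` is the restriction of a class on
`X_{n+2}` dying on `X_k`. Paper proof of the card: Hu Cor. 10.5(i) (`i = 0`):
`K₀(X_{n+2},X_1) ≅ ⊕_r ℍ^{2r-1}(X_1,p^{r,1}_{r,n+2}Ω•)` surjects onto the kernel and is natural in the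
level (Prop. 9.6), and the coherent transition `ℍ^{2r-1}(p^{r,1}_{r,n+2}Ω•) → ℍ^{2r-1}(p^{r,1}_{r,n+1}Ω•)`
is ONTO under torsion-free `H^b(𝒪)`, `H^b(Ω¹)` (d ≤ 3; all `Ω^j` on the Ω¹-free branch). -/
def KernelTower : Prop :=
  ∀ (p : ℕ) [Fact p.Prime] (k : Type) [Field k] [CharP k p] [PerfectRing k p] (d : ℕ)
    (𝒳 : SchemeOver (WittVector p k)), CruxHypotheses p k d 𝒳 →
    ∀ (n : ℕ) (t : KTheory.KZero (thickening 𝒳 (n + 1)).left),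
      KTheory.KZero.map (specialFibreToThickening 𝒳 n) t = 0 →
      ∃ t' : KTheory.KZero (thickening 𝒳 (n + 2)).left,
        KTheory.KZero.map (specialFibreToThickening 𝒳 (n + 1)) t' = 0 ∧
        KTheory.KZero.map (thickeningMap 𝒳 (Nat.le_succ (n + 1))) t' = t

/-- **Composition of the `hu-infinitesimal-obstruction` line** (sorry-free, over the landed glue):
level-wise (1_K) and (2_K) imply the crux BY NAME. -/
theorem crux_of_levelwise_of_kernelTower (h₁ : LevelwiseClassLift) (h₂ : KernelTower) :
    FormalLiftingFromClassLifting := by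
  intro p _ k _ _ _ d 𝒳 h𝒳 hproj hp hO hΩ hd E₁ hE₁ hstar hξ
  have hH : CruxHypotheses p k d 𝒳 := ⟨h𝒳, hproj, hp, hO, hΩ, hd⟩
  exact Glue.liftsFormally_of_stepClassLifting hE₁ hstar
    (Glue.stepClassLifting_of_levelwiseLifts_of_kernelTower hE₁ (h₁ p k d 𝒳 hH E₁ hE₁ hξ)
      (h₂ p k d 𝒳 hH))

/-- **Card `stable-range-devissage`, first lemma (SERRE-SPLITTING SHADOW).** For a smooth proper
model `𝒳/W(k)` of relative dimension `d`, projective over `W`, with `k` infinite, the Grothendieck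
group of every thickening `X_{m+1}` is generated by classes of finite locally free modules of rank at
most `d` (a globally generated bundle of rank `> d = dim X_{m+1}` has a nowhere-vanishing section
after an ample twist, so it is an extension of a bundle of rank one less by a line bundle). -/
def StableRangeGeneration : Prop :=
  ∀ (p : ℕ) [Fact p.Prime] (k : Type) [Field k] [CharP k p] [Infinite k] (d : ℕ)
    (𝒳 : SchemeOver (WittVector p k)), IsSmoothProperModel d 𝒳 →
    Crystalline.IsProjectiveOverRing 𝒳 →
    ∀ m : ℕ, AddSubgroup.closure
      {x : KTheory.KZero (thickening 𝒳 (m + 1)).left |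
        ∃ (F : (thickening 𝒳 (m + 1)).left.Modules) (hF : IsFiniteLocallyFree F) (r : ℕ),
          r ≤ d ∧ HasRank F r ∧ x = KTheory.KZero.of F hF} = ⊤

/-- **Card `stable-range-devissage`, the surface corner.** For `d ≤ 2`, `p` odd and ONLY
`H²(𝒳,𝒪)[p] = 0` (no `Ω¹` hypothesis, no bound on `p`): level-wise (1_K) for every rationally
pro-liftable `[E₁]` AND the kernel tower (2_K). Paper proof of the card: `K₀` of a thickened surface
is generated by line bundles and perfect point classes (`StableRangeGeneration` + a regular section of
a rank-2 bundle vanishes on a 0-dimensional lci subscheme with Koszul class); point classes lift along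
the whole tower (Hensel: `W_m(κ)`-multisections, Tor-independence); a class lifts one step iff its
determinant does; kernel line bundles extend iff `H¹(X_{m+1},𝒪) ↠ H¹(X_m,𝒪)` iff `H²(𝒳,𝒪)[p] = 0`;
`det E₁` pro-lifts from `(det E₁)^L` because `coker(Pic 𝒳̂ → Pic X_k) ↪ H²(𝒳̂,1+p𝒪) ≅ H²(𝒳,𝒪)`
(p-adic log, `p` odd) is torsion-free. (`k` infinite for the general-position sections; finite `k`
needs a finite-field Bertini — recorded in the card as the residual.) -/
def SurfaceTowerFromPic : Prop :=
  ∀ (p : ℕ) [Fact p.Prime] (k : Type) [Field k] [CharP k p] [PerfectRing k p] [Infinite k] (d : ℕ)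
    (𝒳 : SchemeOver (WittVector p k)), IsSmoothProperModel d 𝒳 →
    Crystalline.IsProjectiveOverRing 𝒳 → d ≤ 2 → p ≠ 2 →
    (∀ x : structureSheafCohomology 𝒳.left 2, (p : ℤ) • x = 0 → x = 0) →
    (∀ (E₁ : (specialFibre 𝒳).left.Modules) (hE₁ : IsFiniteLocallyFree E₁),
      RationalProLift 𝒳 E₁ hE₁ →
      ∀ n : ℕ, ∃ z : KTheory.KZero (thickening 𝒳 (n + 1)).left,
        KTheory.KZero.map (specialFibreToThickening 𝒳 n) z = KTheory.KZero.of E₁ hE₁) ∧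
    (∀ (n : ℕ) (t : KTheory.KZero (thickening 𝒳 (n + 1)).left),
      KTheory.KZero.map (specialFibreToThickening 𝒳 n) t = 0 →
      ∃ t' : KTheory.KZero (thickening 𝒳 (n + 2)).left,
        KTheory.KZero.map (specialFibreToThickening 𝒳 (n + 1)) t' = 0 ∧
        KTheory.KZero.map (thickeningMap 𝒳 (Nat.le_succ (n + 1))) t' = t)

end

end Summit.HodgeConjecture.HodgeConjecture.Cruxes.FormalLiftingFromClassLifting.IdeatorFour
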